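import Literature.NumberTheory.Transcendental.DeRhamTheoremCechProofs
import HarnessLib

/-!
# Nested chart-convex finite covers of a compact manifold (the Leray covers of Cartan–Serre)

Continuation of Part II of `DeRhamTheoremCechProofs.lean` (`exists_chartConvexCover`: a compact
boundaryless `C^∞` manifold on a finite-dimensional model has a finite cover by chart balls all of
whose finite intersections are chart sets of open convex sets). The Cartan–Serre finiteness theorem
by the Čech method (H. Cartan, J.-P. Serre (1953); H. Grauert, R. Remmert, *Theorie der Steinschen
Räume* (1977), Kap. VI §4: "Meßatlanten `𝔘'' < 𝔘' < 𝔘 < 𝔘*`") needs SEVERAL such covers, indexed by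
the same finite set, NESTED with closure containments, and whose finite intersections at all levels
are chart sets of convex opens in ONE chart depending only on the tuple of indices:

* `exists_nestedChartConvexCovers L` — for every `L` there are a finite `s ⊆ M` and covers
  `U l : ↥s → Set M`, `l : Fin (L + 1)` (chart balls of radii `r · 2^l / 2^L` around the same
  centres in the same charts) with: every `U l i` open; every level covers `M`; `U l i ⊆ U l' i`
  for `l ≤ l'`; **`closure (U_l,J) ⊆ U_{l',J}` for `l < l'`** on all finite intersections; and for
  every tuple `J` ONE point `p` such that at every level the (nonempty) intersection `U_{l,J}` is
  the chart set `chartSet 𝓘(ℝ, E) p C` of an open convex `C ⊆ (chartAt E p).target`.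

The construction is the one of `exists_chartConvexCover` (Euclidean chart balls small enough for
`Literature.Analysis.Convexity.exists_radius_convex_image_ball` in every nearby chart, a Lebesgue
number and compactness), run with the finite subcover extracted at the smallest radius; the
closure containment is the continuity of the inverse chart on the closed Euclidean ball.
Everything is proved; no definitions.

## References

* H. Grauert, R. Remmert, *Theorie der Steinschen Räume* (1977), Kap. VI §3–§4 (Meßatlanten,
  `𝔘'' < 𝔘' < 𝔘 < 𝔘*`). [GrauertRemmert1977]
* R. Bott, L. W. Tu, *Differential Forms in Algebraic Topology* (1982), Thm. 5.1 (good covers).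
  [BottTu1982Forms]
-/

noncomputable section

open scoped Manifold ContDiff Topology
open Set Metric Filter Literature.Geometry.Kaehler Literature.Analysis.Convexity

universe u

namespace Literature.NumberTheory.Transcendental

variable {E : Type*} [NormedAddCommGroup E] [NormedSpace ℝ E] [FiniteDimensional ℝ E]
  {M : Type u} [TopologicalSpace M] [ChartedSpace E M]

/-- Smaller radius, smaller Euclidean chart ball. [folklore] -/
theorem eball_mono (p z : M) {r r' : ℝ} (h : r ≤ r') : eball E p z r ⊆ eball E p z r' :=
  inter_subset_inter_right _ (preimage_mono (ball_subset_ball h))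

/-- **Closure of a smaller chart ball inside a bigger one**: if the inverse chart is defined on the
Euclidean ball of radius `R` around `ψ_p z` (`toEuclidean⁻¹ v ∈ target_p` there) and `r < r' ≤ R`, then
`closure B(z; p, r) ⊆ B(z; p, r')` (the image of the closed ball of radius `r` under the
continuous inverse chart is compact, hence closed, and lies in between). [folklore] -/
theorem closure_eball_subset [T2Space M] {p z : M} {r r' R : ℝ} (hr : r < r') (hr' : r' ≤ R)
    (hB : ∀ v ∈ ball (echart E p z) R, (toEuclidean (E := E)).symm v ∈ (chartAt E p).target) :
    closure (eball E p z r) ⊆ eball E p z r' := by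
  -- the image `A` of the closed ball of radius `r`
  set A := echartInv E p '' closedBall (echart E p z) r with hA
  have hsub : closedBall (echart E p z) r ⊆ ball (echart E p z) R :=
    closedBall_subset_ball (hr.trans_le hr')
  have hT : ∀ v ∈ closedBall (echart E p z) r, (toEuclidean (E := E)).symm v ∈ (chartAt E p).target := fun v hv ↦
    hB v (hsub hv)
  have hcont : ContinuousOn (echartInv E p) (closedBall (echart E p z) r) := by
    refine ((chartAt E p).continuousOn_symm.comp (toEuclidean (E := E)).symm.continuous.continuousOn ?_)
    exact fun v hv ↦ hT v hv
  have hAc : IsCompact A := (isCompact_closedBall _ _).image_of_continuousOn hcont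
  have h1 : eball E p z r ⊆ A := by
    rintro x ⟨hx, hxb⟩
    exact ⟨echart E p x, ball_subset_closedBall hxb, echartInv_echart hx⟩
  have h2 : A ⊆ eball E p z r' := by
    rintro _ ⟨v, hv, rfl⟩
    refine ⟨(chartAt E p).map_target (hT v hv), ?_⟩
    show echart E p (echartInv E p v) ∈ ball (echart E p z) r'
    rw [echart_echartInv (hT v hv)]
    exact closedBall_subset_ball hr hv
  exact (closure_minimal h1 hAc.isClosed).trans h2

/-- The closure of a finite intersection lies in the finite intersection of larger sets containing
the closures. [folklore] -/
theorem closure_cechSet_subset_cechSet {ι : Type*} {U U' : ι → Set M}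
    (h : ∀ i, closure (U i) ⊆ U' i) {n : ℕ} (J : Fin n → ι) :
    closure (cechSet U J) ⊆ cechSet U' J := by
  have h1 : closure (cechSet U J) ⊆ ⋂ k, closure (U (J k)) :=
    closure_minimal (fun x hx ↦ mem_iInter.2 fun k ↦ subset_closure (mem_cechSet_iff.1 hx k))
      (isClosed_iInter fun k ↦ isClosed_closure)
  exact h1.trans (iInter_mono fun k ↦ h (J k))

/-- **Compact boundaryless manifolds have nested chart-convex finite covers** (the Leray
"Meßatlanten" `𝔘_0 < 𝔘_1 < ⋯ < 𝔘_L` of Grauert–Remmert (1977), Kap. VI, realised by Euclidean chart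
balls of radii `r 2^l / 2^L` about the same centres): for every `L` there are a finite index set
`s ⊆ M` and covers `U l`, `l ≤ L`, by open sets, increasing in `l`, with
`closure U_{l,J} ⊆ U_{l',J}` for `l < l'` on all finite intersections, and for every tuple `J` one
chart centre `p` in which every nonempty `U_{l,J}` is the chart set of an open convex subset of the
chart target. [cite: GrauertRemmert1977, Kap. VI §4] -/
theorem exists_nestedChartConvexCovers [IsManifold 𝓘(ℝ, E) ∞ M] [T2Space M] [CompactSpace M]
    (L : ℕ) :
    ∃ (s : Finset M) (U : Fin (L + 1) → ↥s → Set M),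
      (∀ l i, IsOpen (U l i)) ∧ (∀ l, ⋃ i, U l i = univ) ∧
      (∀ l l', l ≤ l' → ∀ i, U l i ⊆ U l' i) ∧
      (∀ l l', l < l' → ∀ (n : ℕ) (J : Fin n → ↥s), closure (cechSet (U l) J) ⊆ cechSet (U l') J) ∧
      (∀ (n : ℕ) (J : Fin (n + 1) → ↥s), ∃ p : M, ∀ l, (cechSet (U l) J).Nonempty →
        ∃ C : Set E, IsOpen C ∧ Convex ℝ C ∧ C ⊆ (chartAt E p).target ∧
          cechSet (U l) J = chartSet 𝓘(ℝ, E) p C) := by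
  classical
  rcases isEmpty_or_nonempty M with hM | hM
  · exact ⟨∅, fun _ _ ↦ ∅, fun _ _ ↦ isOpen_empty, fun _ ↦ eq_univ_of_forall fun x ↦ isEmptyElim x,
      fun _ _ _ _ ↦ Subset.rfl, fun _ _ _ n J x _ ↦ isEmptyElim x,
      fun n J ↦ absurd (J 0).2 (Finset.notMem_empty _)⟩
  -- a metric on `M`
  letI : TopologicalSpace.MetrizableSpace M := Manifold.metrizableSpace 𝓘(ℝ, E) M
  letI : MetricSpace M := TopologicalSpace.metrizableSpaceMetric M
  -- a finite atlas and a Lebesgue number `3η`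
  obtain ⟨t, ht⟩ : ∃ t : Finset M, (univ : Set M) ⊆ ⋃ p ∈ t, (chartAt E p).source :=
    isCompact_univ.elim_finite_subcover (fun p : M ↦ (chartAt E p).source)
      (fun p ↦ (chartAt E p).open_source) fun x _ ↦ mem_iUnion.2 ⟨x, mem_chart_source E x⟩
  have htne : t.Nonempty := by
    obtain ⟨x⟩ := hM
    obtain ⟨p, hp, -⟩ := mem_iUnion₂.1 (ht (mem_univ x))
    exact ⟨p, hp⟩
  obtain ⟨lam, hlam, hleb⟩ := lebesgue_number_lemma_of_metric (ι := ↥t)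
    (c := fun p ↦ (chartAt E (p : M)).source) isCompact_univ (fun p ↦ (chartAt E (p : M)).open_source)
    (fun x _ ↦ by
      obtain ⟨p, hp, hx⟩ := mem_iUnion₂.1 (ht (mem_univ x))
      exact mem_iUnion.2 ⟨⟨p, hp⟩, hx⟩)
  haveI : Nonempty ↥t := htne.coe_sort
  choose! jt hjt using hleb
  set j : M → M := fun x ↦ (jt x : M) with hj
  have hjmem : ∀ x, j x ∈ t := fun x ↦ (jt x).2
  have hjball : ∀ x, ball x lam ⊆ (chartAt E (j x)).source := fun x ↦ hjt x (mem_univ x)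
  set η := lam / 3 with hη
  have hηpos : 0 < η := by positivity
  have hηlam : η ≤ lam := by rw [hη]; linarith
  -- the compact cores `Q p = {z | B_d(z, η) ⊆ source_p}`
  set Q : M → Set M := fun p ↦ {z | ∀ w, w ∉ (chartAt E p).source → η ≤ dist z w} with hQ
  have hQclosed : ∀ p, IsClosed (Q p) := fun p ↦ by
    simp only [hQ, setOf_forall]
    exact isClosed_iInter fun w ↦ isClosed_iInter fun _ ↦
      isClosed_le continuous_const (continuous_id.dist continuous_const)
  have hQcpt : ∀ p, IsCompact (Q p) := fun p ↦ (hQclosed p).isCompact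
  have hQball : ∀ p z, z ∈ Q p ↔ ball z η ⊆ (chartAt E p).source := fun p z ↦ by
    constructor
    · intro hz w hw
      by_contra hws
      have h := hz w hws
      rw [mem_ball, dist_comm] at hw
      exact absurd hw (not_lt.2 h)
    · intro hz w hws
      by_contra hlt
      exact hws (hz (by rw [mem_ball, dist_comm]; exact not_le.1 hlt))
  have hQsrc : ∀ p, Q p ⊆ (chartAt E p).source := fun p z hz ↦
    (hQball p z).1 hz (mem_ball_self hηpos)
  -- (a) uniform continuity of `ψ_p⁻¹` near `ψ_p (Q p)`: radii `r₁ p`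
  have stepA : ∀ p : M, ∃ r₁ > 0, ∀ z ∈ Q p, ∀ r, r ≤ r₁ →
      (∀ v ∈ ball (echart E p z) r, (toEuclidean (E := E)).symm v ∈ (chartAt E p).target) ∧
        eball E p z r ⊆ ball z η := by
    intro p
    set T := (toEuclidean (E := E)).symm ⁻¹' (chartAt E p).target with hT
    have hTo : IsOpen T := (chartAt E p).open_target.preimage (toEuclidean (E := E)).symm.continuous
    set K := echart E p '' Q p with hK
    have hψc : ContinuousOn (echart E p) (chartAt E p).source :=
      (toEuclidean (E := E)).continuous.comp_continuousOn (chartAt E p).continuousOn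
    have hKc : IsCompact K := (hQcpt p).image_of_continuousOn (hψc.mono (hQsrc p))
    have hKT : K ⊆ T := by
      rintro _ ⟨z, hz, rfl⟩
      show (toEuclidean (E := E)).symm (toEuclidean (E := E) (chartAt E p z)) ∈ (chartAt E p).target
      rw [ContinuousLinearEquiv.symm_apply_apply]
      exact (chartAt E p).map_source (hQsrc p hz)
    obtain ⟨δ, hδ, hCT⟩ := hKc.exists_cthickening_subset_open hTo hKT
    have hCc : IsCompact (cthickening δ K) := hKc.cthickening
    have hFc : ContinuousOn (echartInv E p) T :=
      (chartAt E p).continuousOn_symm.comp (toEuclidean (E := E)).symm.continuous.continuousOn fun v hv ↦ hv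
    have hFu := hCc.uniformContinuousOn_of_continuous (hFc.mono hCT)
    obtain ⟨r₀, hr₀, hr₀u⟩ := Metric.uniformContinuousOn_iff.1 hFu η hηpos
    refine ⟨min r₀ δ, lt_min hr₀ hδ, fun z hz r hr ↦ ?_⟩
    have hzK : echart E p z ∈ K := ⟨z, hz, rfl⟩
    have hballC : ∀ v ∈ ball (echart E p z) r, v ∈ cthickening δ K := fun v hv ↦
      closedBall_subset_cthickening hzK δ
        (mem_closedBall.2 ((mem_ball.1 hv).le.trans (hr.trans (min_le_right _ _))))
    refine ⟨fun v hv ↦ hCT (hballC v hv), fun x hx ↦ ?_⟩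
    have hxv : echart E p x ∈ ball (echart E p z) r := hx.2
    have hd := hr₀u (echart E p x) (hballC _ hxv) (echart E p z)
      (self_subset_cthickening K hzK) ((mem_ball.1 hxv).trans_le (hr.trans (min_le_left _ _)))
    rw [echartInv_echart hx.1, echartInv_echart (hQsrc p hz)] at hd
    exact mem_ball.2 hd
  choose r₁ hr₁pos hr₁ using stepA
  -- (b) convexity of transported balls: radii `ρ p q`
  have stepB : ∀ p q : M, ∃ ρ > 0, ∀ c ∈ echart E p '' (Q p ∩ Q q), ∀ r, 0 < r → r ≤ ρ →
      ball c r ⊆ edom E p q ∧ Convex ℝ (etrans E p q '' ball c r) := by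
    intro p q
    have hψc : ContinuousOn (echart E p) (chartAt E p).source :=
      (toEuclidean (E := E)).continuous.comp_continuousOn (chartAt E p).continuousOn
    have hKc : IsCompact (echart E p '' (Q p ∩ Q q)) :=
      ((hQcpt p).inter_right (hQclosed q)).image_of_continuousOn
        (hψc.mono (inter_subset_left.trans (hQsrc p)))
    have hKD : echart E p '' (Q p ∩ Q q) ⊆ edom E p q := by
      rintro _ ⟨z, hz, rfl⟩
      rw [mem_edom_iff]
      refine ⟨?_, ?_⟩
      · show (toEuclidean (E := E)).symm (toEuclidean (E := E) (chartAt E p z)) ∈ (chartAt E p).target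
        rw [ContinuousLinearEquiv.symm_apply_apply]
        exact (chartAt E p).map_source (hQsrc p hz.1)
      · rw [echartInv_echart (hQsrc p hz.1)]
        exact hQsrc q hz.2
    have h2 : (2 : WithTop ℕ∞) ≤ ∞ := by decide
    exact exists_radius_convex_image_ball (isOpen_edom p q) (isOpen_edom q p)
      ((contDiffOn_etrans p q).of_le h2) ((contDiffOn_etrans q p).of_le h2) (mapsTo_etrans p q)
      (mapsTo_etrans q p) (fun x hx ↦ etrans_etrans hx) (fun y hy ↦ etrans_etrans hy) hKc hKD
  choose ρ hρpos hρ using stepB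
  -- one radius `rr` below all `r₁ p` (`p ∈ t`) and all `ρ p q` (`p, q ∈ t`)
  set rr := min (t.inf' htne r₁) ((t ×ˢ t).inf' (htne.product htne) fun pq ↦ ρ pq.1 pq.2) with hrr
  have hrrpos : 0 < rr := by
    refine lt_min ((Finset.lt_inf'_iff _).2 fun p _ ↦ hr₁pos p)
      ((Finset.lt_inf'_iff _).2 fun pq _ ↦ hρpos pq.1 pq.2)
  have hrr₁ : ∀ p ∈ t, rr ≤ r₁ p := fun p hp ↦
    (min_le_left _ _).trans (Finset.inf'_le _ hp)
  have hrrρ : ∀ p ∈ t, ∀ q ∈ t, rr ≤ ρ p q := fun p hp q hq ↦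
    (min_le_right _ _).trans (Finset.inf'_le (fun pq : M × M ↦ ρ pq.1 pq.2)
      (Finset.mk_mem_product hp hq))
  -- the radii of the levels: `rad l = rr * 2^l / 2^L`
  set rad : Fin (L + 1) → ℝ := fun l ↦ rr * 2 ^ (l : ℕ) / 2 ^ L with hrad
  have hradpos : ∀ l, 0 < rad l := fun l ↦ by rw [hrad]; positivity
  have hradle : ∀ l, rad l ≤ rr := fun l ↦ by
    rw [hrad, div_le_iff₀ (by positivity)]
    have hl : (2 : ℝ) ^ (l : ℕ) ≤ 2 ^ L := pow_le_pow_right₀ (by norm_num) (Nat.lt_succ_iff.1 l.2)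
    nlinarith
  have hradmono : ∀ l l' : Fin (L + 1), l ≤ l' → rad l ≤ rad l' := fun l l' h ↦ by
    rw [hrad]
    have hl : (2 : ℝ) ^ (l : ℕ) ≤ 2 ^ (l' : ℕ) := pow_le_pow_right₀ (by norm_num) h
    simp only
    gcongr
  have hradlt : ∀ l l' : Fin (L + 1), l < l' → rad l < rad l' := fun l l' h ↦ by
    rw [hrad]
    have hl : (2 : ℝ) ^ (l : ℕ) < 2 ^ (l' : ℕ) := pow_lt_pow_right₀ (by norm_num) h
    simp only
    gcongr
  -- the balls `W l x = B(x; j x, rad l)` and a finite subcover AT THE SMALLEST RADIUS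
  set W : Fin (L + 1) → M → Set M := fun l x ↦ eball E (j x) x (rad l) with hW
  have hWo : ∀ l x, IsOpen (W l x) := fun l x ↦ isOpen_eball _ _ _
  have hxQ : ∀ x, x ∈ Q (j x) := fun x ↦ (hQball _ _).2 ((ball_subset_ball hηlam).trans (hjball x))
  have hxW : ∀ l x, x ∈ W l x := fun l x ↦ mem_eball (hQsrc _ (hxQ x)) (hradpos l)
  have hWsmall : ∀ l x, W l x ⊆ ball x η := fun l x ↦
    (hr₁ (j x) x (hxQ x) (rad l) ((hradle l).trans (hrr₁ _ (hjmem x)))).2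
  have hWmono : ∀ l l', l ≤ l' → ∀ x, W l x ⊆ W l' x := fun l l' h x ↦ eball_mono _ _ (hradmono l l' h)
  have hWcl : ∀ l l', l < l' → ∀ x, closure (W l x) ⊆ W l' x := fun l l' h x ↦
    closure_eball_subset (hradlt l l' h) (hradle l')
      (hr₁ (j x) x (hxQ x) rr (hrr₁ _ (hjmem x))).1
  obtain ⟨s, hs⟩ := isCompact_univ.elim_finite_subcover (W 0) (hWo 0) fun x _ ↦ mem_iUnion.2 ⟨x, hxW 0 x⟩
  -- the covers
  let U : Fin (L + 1) → ↥s → Set M := fun l i ↦ W l i.1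
  have hUo : ∀ l i, IsOpen (U l i) := fun l i ↦ hWo l i.1
  have hUcov : ∀ l, ⋃ i, U l i = univ := fun l ↦ by
    refine eq_univ_of_forall fun x ↦ ?_
    obtain ⟨i, hi, hx⟩ := mem_iUnion₂.1 (hs (mem_univ x))
    exact mem_iUnion.2 ⟨⟨i, hi⟩, hWmono 0 l (Fin.zero_le l) i hx⟩
  have hUmono : ∀ l l', l ≤ l' → ∀ i, U l i ⊆ U l' i := fun l l' h i ↦ hWmono l l' h i.1
  have hUcl : ∀ l l', l < l' → ∀ (n : ℕ) (J : Fin n → ↥s), closure (cechSet (U l) J) ⊆ cechSet (U l') J :=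
    fun l l' h n J ↦ closure_cechSet_subset_cechSet (U := U l) (U' := U l') (fun i ↦ hWcl l l' h i.1) J
  have hUchart : ∀ (n : ℕ) (J : Fin (n + 1) → ↥s), ∃ p : M, ∀ l, (cechSet (U l) J).Nonempty →
      ∃ C : Set E, IsOpen C ∧ Convex ℝ C ∧ C ⊆ (chartAt E p).target ∧
        cechSet (U l) J = chartSet 𝓘(ℝ, E) p C := by
    intro n J
    -- one chart centre for the tuple: `p = j (J 0)`
    set x₀ : M := (J 0).1 with hx₀
    set p : M := j x₀ with hp
    have hpt : p ∈ t := hjmem x₀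
    refine ⟨p, fun l hne ↦ ?_⟩
    obtain ⟨z₀, hz₀⟩ := hne
    have hz₀k : ∀ k, z₀ ∈ W l (J k).1 := fun k ↦ mem_cechSet_iff.1 hz₀ k
    -- every member lies `η`-close to `x₀`, hence has its centre in `Q p`
    have hcentre : ∀ k, (J k).1 ∈ Q p := fun k ↦ by
      rw [hQball]
      refine Subset.trans ?_ (hjball x₀)
      intro w hw
      rw [mem_ball] at hw ⊢
      have h1 : dist z₀ (J k).1 < η := mem_ball.1 (hWsmall l _ (hz₀k k))
      have h2 : dist z₀ x₀ < η := mem_ball.1 (hWsmall l _ (hz₀k 0))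
      calc dist w x₀ ≤ dist w (J k).1 + dist (J k).1 z₀ + dist z₀ x₀ := dist_triangle4 _ _ _ _
        _ < η + η + η := by rw [dist_comm (J k).1 z₀]; gcongr
        _ = lam := by rw [hη]; ring
    -- hence (b) applies to the ball of `(J k).1` in its own chart `q = j (J k).1`, read in chart `p`
    have hkey : ∀ k, W l (J k).1 ⊆ (chartAt E p).source ∧
        Convex ℝ (chartAt E p '' W l (J k).1) := fun k ↦ by
      set y : M := (J k).1 with hy
      set q : M := j y with hq
      have hcK : echart E q y ∈ echart E q '' (Q q ∩ Q p) := ⟨y, ⟨hxQ y, hcentre k⟩, rfl⟩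
      obtain ⟨hBD, hconv⟩ := hρ q p (echart E q y) hcK (rad l) (hradpos l)
        ((hradle l).trans (hrrρ q (hjmem y) p hpt))
      obtain ⟨hsub, himg⟩ := eball_subset_source_and_image (E := E) hBD
      refine ⟨hsub, ?_⟩
      rw [image_chartAt_eq, himg]
      exact convex_image_symm hconv
    refine ⟨⋂ k, chartAt E p '' W l (J k).1, ?_, ?_, ?_, ?_⟩
    · exact isOpen_iInter_of_finite fun k ↦
        (chartAt E p).isOpen_image_of_subset_source (hWo _ _) (hkey k).1
    · exact convex_iInter fun k ↦ (hkey k).2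
    · exact (iInter_subset _ 0).trans (image_subset_iff.2 fun x hx ↦ (chartAt E p).map_source ((hkey 0).1 hx))
    · rw [chartSet_self_eq, preimage_iInter, inter_iInter]
      refine iInter_congr fun k ↦ ?_
      exact eq_source_inter_preimage_image (hkey k).1
  exact ⟨s, U, hUo, hUcov, hUmono, hUcl, hUchart⟩

end Literature.NumberTheory.Transcendental

end
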